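import Mathlib.GroupTheory.FreeGroup.Reduce
import Summits.SmoothPoincare4.SmoothPoincare4.Theorems.ShadowsStandard.Negative.ShadowLevels

/-!
# Negative lemmas for the crux `ShadowsStandard` (item stmt-SmoothPoincare4-14593), III: certified generators of `Aut S_3`

Refuter toolkit (cdisprove seat, cycle 2). The level-gate computations of the crux work file
(`Cruxes/ShadowsStandard/Disproof.lean` §7) act on `Hom(S_3, Q)` through explicit automorphisms of the
genus-3 surface group `S_3 = ⟨a₁,b₁,a₂,b₂,a₃,b₃ ∣ [a₁,b₁][a₂,b₂][a₃,b₃]⟩` (tree convention, `[x,y] = xyx⁻¹y⁻¹`,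
generators `(i,false) = a_{i+1}`, `(i,true) = b_{i+1}`). This file makes those automorphisms
kernel-checked objects: each is built from a substitution `σ` on generators whose action on the
relator is verified by `decide` in the free group (`lift σ R = u R^{±1} u⁻¹` literally), together with
an inverse substitution, and the handlebody kernels `s4Kernels i` it stabilises are certified the same
way (membership in `s4Kernels i` is decidable: erase the killed generators, `mk_mem_s4Kernels_iff`).

* `substEndo`, `substEquiv` — endomorphisms / automorphisms of `S_3` from relator-preserving substitutions.
* The Lickorish twists `twistA i : bᵢ ↦ bᵢaᵢ`, `twistB i : aᵢ ↦ aᵢbᵢ`, the chain twists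
  `twistC1 : b₁ ↦ c b₁, a₂ ↦ c a₂ c⁻¹, b₂ ↦ b₂ c⁻¹` (`c = b₁a₁⁻¹b₁⁻¹a₂`, class `a₂ − a₁`) and `twistC2`
  (handles 2,3), the handle rotation `rot` and the orientation reversal `flip : a₁↔b₃, b₁↔a₃, a₂↔b₂`
  (`R ↦ R⁻¹`). By Lickorish (1964) and Dehn–Nielsen–Baer the twists, `flip` and `Inn S_3` generate
  `Aut S_3` (cited, not formalised).
* `ker_eraseHom_s4Gens`, `mk_mem_s4Kernels_iff` — `w ∈ s4Kernels i` iff erasing `s4Gens i` kills `w`.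
* `map_s4Kernels_eq` and the twelve incidences `twistA 0` stabilises `s4Kernels 0` and `s4Kernels 1`, …,
  exactly the table used by the computation (`comp/sg.py`).

Nothing here mentions the crux; pure group theory over `GroupTrisections.lean`.
-/

noncomputable section

namespace Summit.SmoothPoincare4.SmoothPoincare4.Theorems.ShadowsStandard.Negative

open Literature.Topology.FourManifolds Subgroup

/-! ## §1 Endomorphisms and automorphisms from substitutions -/

/-- The genus-3 relator. [folklore] -/
abbrev R3 : FreeGroup (surfaceGen 3) := surfaceRelator 3

/-- The quotient map `F_6 →* S_3`. [folklore] -/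
abbrev mk3 : FreeGroup (surfaceGen 3) →* SurfaceGroup 3 :=
  PresentedGroup.mk ({surfaceRelator 3} : Set (FreeGroup (surfaceGen 3)))

/-- The relator dies in `S_3`. [folklore] -/
theorem mk3_R3 : mk3 R3 = 1 :=
  (QuotientGroup.eq_one_iff R3).mpr (subset_normalClosure (Set.mem_singleton _))

/-- Lifting a substitution through `mk3`. [folklore] -/
theorem lift_mk3_comp (σ : surfaceGen 3 → FreeGroup (surfaceGen 3)) :
    FreeGroup.lift (fun x => mk3 (σ x)) = mk3.comp (FreeGroup.lift σ) := by
  ext x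
  simp

/-- **Endomorphism of `S_3` from a substitution** `σ` with `lift σ R = u · R^{±1} · u⁻¹` literally in
the free group. [folklore] -/
def substEndo (σ : surfaceGen 3 → FreeGroup (surfaceGen 3)) (u : FreeGroup (surfaceGen 3)) (inv : Bool)
    (h : FreeGroup.lift σ R3 = u * (if inv then R3⁻¹ else R3) * u⁻¹) :
    SurfaceGroup 3 →* SurfaceGroup 3 :=
  PresentedGroup.toGroup (f := fun x => mk3 (σ x)) (by
    intro r hr
    rw [Set.mem_singleton_iff] at hr
    subst hr
    rw [lift_mk3_comp, MonoidHom.comp_apply]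
    change mk3 (FreeGroup.lift σ R3) = 1
    rw [h, map_mul, map_mul, map_inv]
    cases inv
    · simp [mk3_R3]
    · simp [mk3_R3])

/-- `substEndo` on generators. [folklore] -/
@[simp] theorem substEndo_of (σ : surfaceGen 3 → FreeGroup (surfaceGen 3)) (u : FreeGroup (surfaceGen 3))
    (inv : Bool) (h : FreeGroup.lift σ R3 = u * (if inv then R3⁻¹ else R3) * u⁻¹) (x : surfaceGen 3) :
    substEndo σ u inv h (PresentedGroup.of x) = mk3 (σ x) :=
  PresentedGroup.toGroup.of _

/-- `substEndo` on words. [folklore] -/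
theorem substEndo_mk3 (σ : surfaceGen 3 → FreeGroup (surfaceGen 3)) (u : FreeGroup (surfaceGen 3))
    (inv : Bool) (h : FreeGroup.lift σ R3 = u * (if inv then R3⁻¹ else R3) * u⁻¹)
    (w : FreeGroup (surfaceGen 3)) :
    substEndo σ u inv h (mk3 w) = mk3 (FreeGroup.lift σ w) := by
  have : (substEndo σ u inv h).comp mk3 = mk3.comp (FreeGroup.lift σ) := by
    ext x
    change substEndo σ u inv h (PresentedGroup.of x) = mk3 (FreeGroup.lift σ (FreeGroup.of x))
    rw [substEndo_of, FreeGroup.lift_apply_of]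
  exact DFunLike.congr_fun this w

/-- **Automorphism of `S_3` from a substitution and an inverse substitution** (inverse verified in the
free group on generators). [folklore] -/
def substEquiv (σ τ : surfaceGen 3 → FreeGroup (surfaceGen 3)) (uσ uτ : FreeGroup (surfaceGen 3))
    (iσ iτ : Bool)
    (hσ : FreeGroup.lift σ R3 = uσ * (if iσ then R3⁻¹ else R3) * uσ⁻¹)
    (hτ : FreeGroup.lift τ R3 = uτ * (if iτ then R3⁻¹ else R3) * uτ⁻¹)
    (h1 : ∀ x, FreeGroup.lift τ (σ x) = FreeGroup.of x)
    (h2 : ∀ x, FreeGroup.lift σ (τ x) = FreeGroup.of x) :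
    SurfaceGroup 3 ≃* SurfaceGroup 3 :=
  MonoidHom.toMulEquiv (substEndo σ uσ iσ hσ) (substEndo τ uτ iτ hτ)
    (by
      apply PresentedGroup.ext
      intro x
      rw [MonoidHom.comp_apply, MonoidHom.id_apply, substEndo_of, substEndo_mk3, h1]
      rfl)
    (by
      apply PresentedGroup.ext
      intro x
      rw [MonoidHom.comp_apply, MonoidHom.id_apply, substEndo_of, substEndo_mk3, h2]
      rfl)

/-- `substEquiv` on generators. [folklore] -/
@[simp] theorem substEquiv_of (σ τ : surfaceGen 3 → FreeGroup (surfaceGen 3))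
    (uσ uτ : FreeGroup (surfaceGen 3)) (iσ iτ : Bool)
    (hσ : FreeGroup.lift σ R3 = uσ * (if iσ then R3⁻¹ else R3) * uσ⁻¹)
    (hτ : FreeGroup.lift τ R3 = uτ * (if iτ then R3⁻¹ else R3) * uτ⁻¹)
    (h1 : ∀ x, FreeGroup.lift τ (σ x) = FreeGroup.of x)
    (h2 : ∀ x, FreeGroup.lift σ (τ x) = FreeGroup.of x) (x : surfaceGen 3) :
    substEquiv σ τ uσ uτ iσ iτ hσ hτ h1 h2 (PresentedGroup.of x) = mk3 (σ x) :=
  substEndo_of σ uσ iσ hσ x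

/-- … and its inverse on generators. [folklore] -/
@[simp] theorem substEquiv_symm_of (σ τ : surfaceGen 3 → FreeGroup (surfaceGen 3))
    (uσ uτ : FreeGroup (surfaceGen 3)) (iσ iτ : Bool)
    (hσ : FreeGroup.lift σ R3 = uσ * (if iσ then R3⁻¹ else R3) * uσ⁻¹)
    (hτ : FreeGroup.lift τ R3 = uτ * (if iτ then R3⁻¹ else R3) * uτ⁻¹)
    (h1 : ∀ x, FreeGroup.lift τ (σ x) = FreeGroup.of x)
    (h2 : ∀ x, FreeGroup.lift σ (τ x) = FreeGroup.of x) (x : surfaceGen 3) :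
    (substEquiv σ τ uσ uτ iσ iτ hσ hτ h1 h2).symm (PresentedGroup.of x) = mk3 (τ x) :=
  substEndo_of τ uτ iτ hτ x

/-! ## §2 The generators -/

/-- `aᵢ`, `bᵢ` in the free group. [folklore] -/
abbrev fa (i : Fin 3) : FreeGroup (surfaceGen 3) := FreeGroup.of (i, false)
/-- `bᵢ` in the free group. [folklore] -/
abbrev fb (i : Fin 3) : FreeGroup (surfaceGen 3) := FreeGroup.of (i, true)

/-- Substitution of the Dehn twist about `aᵢ` (`bᵢ ↦ bᵢ aᵢ^{±1}`). [folklore] -/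
def σA (i : Fin 3) (e : Bool) (x : surfaceGen 3) : FreeGroup (surfaceGen 3) :=
  if x = (i, true) then fb i * (if e then (fa i)⁻¹ else fa i) else FreeGroup.of x

/-- Substitution of the Dehn twist about `bᵢ` (`aᵢ ↦ aᵢ bᵢ^{±1}`). [folklore] -/
def σB (i : Fin 3) (e : Bool) (x : surfaceGen 3) : FreeGroup (surfaceGen 3) :=
  if x = (i, false) then fa i * (if e then (fb i)⁻¹ else fb i) else FreeGroup.of x

/-- The chain curve `cᵢ = bᵢ aᵢ⁻¹ bᵢ⁻¹ a_{i+1}` between handles `i` and `i+1` (a diagonal of the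
12-gon; homology class `a_{i+1} − aᵢ`). [folklore] -/
def chainWord (i j : Fin 3) : FreeGroup (surfaceGen 3) := fb i * (fa i)⁻¹ * (fb i)⁻¹ * fa j

/-- Substitution of the Dehn twist about the chain curve between handles `i` and `j = i+1`:
`bᵢ ↦ c bᵢ`, `aⱼ ↦ c aⱼ c⁻¹`, `bⱼ ↦ bⱼ c⁻¹`; with `e = true` the inverse twist (`c ↦ c⁻¹` on the
outside). [folklore] -/
def σC (i j : Fin 3) (e : Bool) (x : surfaceGen 3) : FreeGroup (surfaceGen 3) :=
  let c : FreeGroup (surfaceGen 3) := if e then (chainWord i j)⁻¹ else chainWord i j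
  if x = (i, true) then c * fb i
  else if x = (j, false) then c * fa j * c⁻¹
  else if x = (j, true) then fb j * c⁻¹
  else FreeGroup.of x

/-- Substitution of the handle rotation by `k`: `(i, s) ↦ (i + k, s)`. [folklore] -/
def σRot (k : Fin 3) (x : surfaceGen 3) : FreeGroup (surfaceGen 3) := FreeGroup.of (x.1 + k, x.2)

/-- Substitution of the orientation reversal `a₁ ↔ b₃, b₁ ↔ a₃, a₂ ↔ b₂`: `(i, s) ↦ (2 − i, ¬s)`. [folklore] -/
def σFlip (x : surfaceGen 3) : FreeGroup (surfaceGen 3) := FreeGroup.of (2 - x.1, !x.2)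

/-- **Dehn twist about `aᵢ`** as an automorphism of `S_3`. [folklore] -/
def twistA (i : Fin 3) : SurfaceGroup 3 ≃* SurfaceGroup 3 :=
  substEquiv (σA i false) (σA i true) 1 1 false false
    (by fin_cases i <;> decide) (by fin_cases i <;> decide) (by fin_cases i <;> decide) (by fin_cases i <;> decide)

/-- **Dehn twist about `bᵢ`** as an automorphism of `S_3`. [folklore] -/
def twistB (i : Fin 3) : SurfaceGroup 3 ≃* SurfaceGroup 3 :=
  substEquiv (σB i false) (σB i true) 1 1 false false
    (by fin_cases i <;> decide) (by fin_cases i <;> decide) (by fin_cases i <;> decide) (by fin_cases i <;> decide)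

/-- **Dehn twist about the chain curve `c₁`** (handles 1, 2). [folklore] -/
def twistC1 : SurfaceGroup 3 ≃* SurfaceGroup 3 :=
  substEquiv (σC 0 1 false) (σC 0 1 true) 1 1 false false (by decide) (by decide) (by decide) (by decide)

/-- **Dehn twist about the chain curve `c₂`** (handles 2, 3). [folklore] -/
def twistC2 : SurfaceGroup 3 ≃* SurfaceGroup 3 :=
  substEquiv (σC 1 2 false) (σC 1 2 true) 1 1 false false (by decide) (by decide) (by decide) (by decide)

/-- **Handle rotation** `(aᵢ, bᵢ) ↦ (a_{i+1}, b_{i+1})` (maps `R` to the cyclic conjugate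
`[a₁,b₁]⁻¹ R [a₁,b₁]`). [folklore] -/
def rot : SurfaceGroup 3 ≃* SurfaceGroup 3 :=
  substEquiv (σRot 1) (σRot 2) (fa 0 * fb 0 * (fa 0)⁻¹ * (fb 0)⁻¹)⁻¹
    (fa 0 * fb 0 * (fa 0)⁻¹ * (fb 0)⁻¹ * (fa 1 * fb 1 * (fa 1)⁻¹ * (fb 1)⁻¹))⁻¹ false false
    (by decide) (by decide) (by decide) (by decide)

/-- **Orientation reversal** `a₁ ↔ b₃, b₁ ↔ a₃, a₂ ↔ b₂` (`R ↦ R⁻¹`). [folklore] -/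
def flip : SurfaceGroup 3 ≃* SurfaceGroup 3 :=
  substEquiv σFlip σFlip 1 1 true true (by decide) (by decide) (by decide) (by decide)

/-! ## §3 Decidable membership in the handlebody kernels and the stabiliser table -/

/-- `eraseHom` on words. [folklore] -/
theorem eraseHom_mk3 (S : Finset (surfaceGen 3)) (hS : ∀ i : Fin 3, (i, false) ∈ S ∨ (i, true) ∈ S)
    (w : FreeGroup (surfaceGen 3)) : eraseHom S hS (mk3 w) = FreeGroup.lift (eraseGen S) w := by
  have : (eraseHom S hS).comp mk3 = FreeGroup.lift (eraseGen S) := by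
    ext x
    change eraseHom S hS (PresentedGroup.of x) = FreeGroup.lift (eraseGen S) (FreeGroup.of x)
    rw [eraseHom_of, FreeGroup.lift_apply_of]
  exact DFunLike.congr_fun this w

/-- **The kernel of erasing `s4Gens i` is exactly `s4Kernels i`.** [folklore] -/
theorem ker_eraseHom_s4Gens (i : Fin 3) :
    (eraseHom (s4Gens i) (s4Gens_hits i)).ker = s4Kernels i := by
  apply le_antisymm
  · intro x hx
    haveI : (s4Kernels i).Normal := s4Kernels_isGroupTrisection_holds.normal i
    have hle : s4Kernels i ≤ (eraseHom (s4Gens i) (s4Gens_hits i)).ker :=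
      s4Kernels_le_ker _ (s4Gens_hits i) i (Finset.Subset.refl _)
    let e := quotientEquivFreeGroupErase (s4Gens i) (s4Gens_hits i) (s4Kernels i)
      (fun x hx => of_mem_s4Kernels i hx) hle
    have h1 : e (QuotientGroup.mk x) = 1 := by
      change QuotientGroup.lift (s4Kernels i) (eraseHom (s4Gens i) (s4Gens_hits i)) hle (QuotientGroup.mk x) = 1
      rw [QuotientGroup.lift_mk]
      exact hx
    rw [← QuotientGroup.eq_one_iff]
    exact e.injective (h1.trans e.map_one.symm)
  · exact s4Kernels_le_ker _ (s4Gens_hits i) i (Finset.Subset.refl _)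

/-- **Decidable membership**: `mk w ∈ s4Kernels i` iff erasing `s4Gens i` kills `w` in the free group. [folklore] -/
theorem mk3_mem_s4Kernels_iff (i : Fin 3) (w : FreeGroup (surfaceGen 3)) :
    mk3 w ∈ s4Kernels i ↔ FreeGroup.lift (eraseGen (s4Gens i)) w = 1 := by
  rw [← ker_eraseHom_s4Gens, MonoidHom.mem_ker, eraseHom_mk3]

/-- The standard kernels are normal (instance form). [folklore] -/
instance s4Kernels_normal (i : Fin 3) : (s4Kernels i).Normal := s4Kernels_isGroupTrisection_holds.normal i

/-- **Stabiliser criterion.** An automorphism mapping the killed generators of `s4Kernels i` into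
`s4Kernels i`, in both directions, stabilises `s4Kernels i`. [folklore] -/
theorem map_s4Kernels_eq (e : SurfaceGroup 3 ≃* SurfaceGroup 3) (i : Fin 3)
    (h : ∀ x ∈ s4Gens i, e (PresentedGroup.of x) ∈ s4Kernels i)
    (h' : ∀ x ∈ s4Gens i, e.symm (PresentedGroup.of x) ∈ s4Kernels i) :
    (s4Kernels i).map e.toMonoidHom = s4Kernels i := by
  have key : ∀ f : SurfaceGroup 3 ≃* SurfaceGroup 3,
      (∀ x ∈ s4Gens i, f (PresentedGroup.of x) ∈ s4Kernels i) →
      (s4Kernels i).map f.toMonoidHom ≤ s4Kernels i := by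
    intro f hf
    rw [s4Kernels_eq, Subgroup.map_normalClosure _ _ f.surjective, ← s4Kernels_eq]
    refine normalClosure_le_normal ?_
    rintro _ ⟨_, ⟨x, hx, rfl⟩, rfl⟩
    exact hf x hx
  apply le_antisymm (key e h)
  intro x hx
  refine ⟨e.symm x, key e.symm h' ⟨x, hx, rfl⟩, by simp⟩

/-- Pointwise test used in the table below: the image word of a killed generator is killed by erasing.
[folklore] -/
theorem of_image_mem (i : Fin 3) {w : FreeGroup (surfaceGen 3)} {y : SurfaceGroup 3} (hy : y = mk3 w)
    (hw : FreeGroup.lift (eraseGen (s4Gens i)) w = 1) : y ∈ s4Kernels i := by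
  rw [hy, mk3_mem_s4Kernels_iff]
  exact hw

/-- `twistA i` stabilises `s4Kernels j` whenever `aᵢ` is killed by `s4Kernels j` (six incidences:
`(i,j) ∈ {(0,0),(0,1),(1,0),(1,2),(2,1),(2,2)}`); stated for all pairs with the decidable side
condition. [folklore] -/
theorem map_twistA (i j : Fin 3) (hij : (i, false) ∈ s4Gens j) :
    (s4Kernels j).map (twistA i).toMonoidHom = s4Kernels j := by
  refine map_s4Kernels_eq _ j (fun x hx => ?_) (fun x hx => ?_)
  · refine of_image_mem j (by unfold twistA; rw [substEquiv_of]) ?_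
    revert i j x
    decide
  · refine of_image_mem j (by unfold twistA; rw [substEquiv_symm_of]) ?_
    revert i j x
    decide

/-- `twistB i` stabilises `s4Kernels j` whenever `bᵢ` is killed by `s4Kernels j` (three incidences:
`(0,2)`, `(1,1)`, `(2,0)`). [folklore] -/
theorem map_twistB (i j : Fin 3) (hij : (i, true) ∈ s4Gens j) :
    (s4Kernels j).map (twistB i).toMonoidHom = s4Kernels j := by
  refine map_s4Kernels_eq _ j (fun x hx => ?_) (fun x hx => ?_)
  · refine of_image_mem j (by unfold twistB; rw [substEquiv_of]) ?_
    revert i j x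
    decide
  · refine of_image_mem j (by unfold twistB; rw [substEquiv_symm_of]) ?_
    revert i j x
    decide

/-- `twistC1` stabilises `s4Kernels 0` (`c₁ = b₁a₁⁻¹b₁⁻¹a₂` is a meridian of the first handlebody). [folklore] -/
theorem map_twistC1 : (s4Kernels 0).map twistC1.toMonoidHom = s4Kernels 0 := by
  refine map_s4Kernels_eq _ 0 (fun x hx => ?_) (fun x hx => ?_)
  · refine of_image_mem 0 (by unfold twistC1; rw [substEquiv_of]) ?_
    revert x
    decide
  · refine of_image_mem 0 (by unfold twistC1; rw [substEquiv_symm_of]) ?_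
    revert x
    decide

/-- `twistC2` stabilises `s4Kernels 2` (`c₂ = b₂a₂⁻¹b₂⁻¹a₃` is a meridian of the third handlebody). [folklore] -/
theorem map_twistC2 : (s4Kernels 2).map twistC2.toMonoidHom = s4Kernels 2 := by
  refine map_s4Kernels_eq _ 2 (fun x hx => ?_) (fun x hx => ?_)
  · refine of_image_mem 2 (by unfold twistC2; rw [substEquiv_of]) ?_
    revert x
    decide
  · refine of_image_mem 2 (by unfold twistC2; rw [substEquiv_symm_of]) ?_
    revert x
    decide

end Summit.SmoothPoincare4.SmoothPoincare4.Theorems.ShadowsStandard.Negative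

end
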